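import Summits.CriticalPhenomena.PercolationContinuityZ3.Theorems.SahiRandomClusterLimits
import Literature.Probability.LatticeModels.RandomClusterLimitExistence

/-!
# The infinite-volume random-cluster measures of `ℤ^d` EXIST and are box-TP₂: unconditional packaging

Support file of the Sahi cell (`prim-sahi`, typer seat, generation 16; `--supports stmt-CriticalPhenomena-4575`).
Theorems only (no definitions, no named facts, no sorries).  Generation 16 proved Grimmett's Thm. (4.19)(a) in the tree
(`Literature.Probability.LatticeModels.exists_isRandomClusterLimit`: for `d ≥ 1`, `b ∈ {free, wired}`, `0 ≤ p ≤ 1`,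
`q ≥ 1` the limit `φ^b_{p,q}` exists) and, for ANY such limit, box-TP₂ / positive association for all measurable
monotone functionals / Sahi positivity given `C_n` (`SahiRandomClusterLimits.lean`, stated with an enumeration
`e : Sym2 (Site d) ≃ ℕ`).  This file removes both provisos:

* `nonempty_sym2_site_equiv_nat` — for `d ≥ 1` the pairs of sites are countably infinite (plumbing);
* **`exists_isRandomClusterLimit_isBoxTP2`** — for `d ≥ 1`, `b`, `0 ≤ p ≤ 1`, `q ≥ 1` THERE IS a probability measure
  `P = φ^b_{p,q}` with `IsRandomClusterLimit d b p q P` which is box-TP₂ and positively associated, and satisfies the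
  FKG inequality for all measurable nonnegative monotone functionals;
* **`exists_isRandomClusterLimit_msahiE_nonneg`** (+ `_of_sahiConjecture`) — and which, GIVEN `∀ d', LiebSahiContinuum d' n`
  (⟺ `C_n`), is Sahi-positive of order `n` for all measurable nonnegative monotone functionals;
* `isRandomClusterLimit_isBoxTP2'`, `isRandomClusterLimit_isPositivelyAssociated'`, `isRandomClusterLimit_msahiE_nonneg'`
  — the generation-16 statements with the enumeration hypothesis replaced by `0 < d`.

No sorries, no new axioms.
-/

noncomputable section

namespace Summit.CriticalPhenomena.PercolationContinuityZ3.Theorems.SahiBoxTP2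

open MeasureTheory Set Function Literature.Combinatorics.Sahi2008
open Literature.Probability.LatticeModels Literature.Probability.Percolation
open scoped ENNReal

variable {d : ℕ}

/-- For `d ≥ 1` the pairs of sites of `ℤ^d` form a countably infinite set. [folklore] -/
theorem nonempty_sym2_site_equiv_nat (hd : 0 < d) : Nonempty (Sym2 (Site d) ≃ ℕ) := by
  haveI : NeZero d := ⟨hd.ne'⟩
  haveI : Infinite (Site d) := infinite_site_of_neZero
  haveI : Infinite (Sym2 (Site d)) := Infinite.of_injective Sym2.diag Sym2.diag_injective
  obtain ⟨_⟩ := nonempty_denumerable (Sym2 (Site d))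
  exact ⟨Denumerable.eqv _⟩

variable {b : RCBoundary} {p q : ℝ} {P : Measure (BondConfig (Site d))} {n : ℕ}

/-- `φ^b_{p,q}` is box-TP₂ (`d ≥ 1`, `0 ≤ p ≤ 1`, `q ≥ 1`). [this work] -/
theorem isRandomClusterLimit_isBoxTP2' (hd : 0 < d) (hP : IsRandomClusterLimit d b p q P) (hp : p ∈ Set.Icc (0 : ℝ) 1)
    (hq : 1 ≤ q) : IsBoxTP2 P := by
  obtain ⟨e⟩ := nonempty_sym2_site_equiv_nat hd
  exact isRandomClusterLimit_isBoxTP2 hP hp hq e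

/-- `φ^b_{p,q}` is positively associated (all measurable increasing events; `d ≥ 1`, `q ≥ 1`). [this work] -/
theorem isRandomClusterLimit_isPositivelyAssociated' (hd : 0 < d) (hP : IsRandomClusterLimit d b p q P)
    (hp : p ∈ Set.Icc (0 : ℝ) 1) (hq : 1 ≤ q) : IsPositivelyAssociated P := by
  obtain ⟨e⟩ := nonempty_sym2_site_equiv_nat hd
  exact isRandomClusterLimit_isPositivelyAssociated hP hp hq e

/-- Given `∀ d', LiebSahiContinuum d' n`: `φ^b_{p,q}` is Sahi-positive of order `n` (`d ≥ 1`, `q ≥ 1`). [this work] -/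
theorem isRandomClusterLimit_msahiE_nonneg' (hd : 0 < d) (hP : IsRandomClusterLimit d b p q P)
    (hp : p ∈ Set.Icc (0 : ℝ) 1) (hq : 1 ≤ q) (hL : ∀ d', LiebSahiContinuum d' n) (f : Fin n → BondConfig (Site d) → ℝ)
    (hfm : ∀ i, Measurable (f i)) (hf0 : ∀ i x, 0 ≤ f i x) (hmono : ∀ i, Monotone (f i)) : 0 ≤ msahiE P n f := by
  obtain ⟨e⟩ := nonempty_sym2_site_equiv_nat hd
  exact isRandomClusterLimit_msahiE_nonneg hP hp hq e hL f hfm hf0 hmono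

/-- **THE INFINITE-VOLUME RANDOM-CLUSTER MEASURE `φ^b_{p,q}` EXISTS, IS BOX-TP₂ AND POSITIVELY ASSOCIATED, with the FKG
inequality for ALL measurable nonnegative monotone functionals** (`d ≥ 1`, `b` free or wired, `0 ≤ p ≤ 1`, `q ≥ 1`).
[this work; cite: Grimmett2006, Thm. (4.19)(a) (existence), Thm. (4.17)(c) (positive association, local form)] -/
theorem exists_isRandomClusterLimit_isBoxTP2 (hd : 0 < d) (b : RCBoundary) (hp : p ∈ Set.Icc (0 : ℝ) 1) (hq : 1 ≤ q) :
    ∃ P : Measure (BondConfig (Site d)), IsRandomClusterLimit d b p q P ∧ IsProbabilityMeasure P ∧ IsBoxTP2 P ∧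
      IsPositivelyAssociated P ∧
      ∀ f g : BondConfig (Site d) → ℝ, Measurable f → Measurable g → (∀ x, 0 ≤ f x) → (∀ x, 0 ≤ g x) →
        Monotone f → Monotone g → (∫ x, f x ∂P) * (∫ x, g x ∂P) ≤ ∫ x, f x * g x ∂P := by
  obtain ⟨P, hP⟩ := exists_isRandomClusterLimit hd b hp hq
  obtain ⟨e⟩ := nonempty_sym2_site_equiv_nat hd
  exact ⟨P, hP, hP.isProbabilityMeasure, isRandomClusterLimit_isBoxTP2 hP hp hq e,
    isRandomClusterLimit_isPositivelyAssociated hP hp hq e,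
    fun f g hfm hgm hf0 hg0 hf hg => isRandomClusterLimit_integral_mul_integral_le hP hp hq e hfm hgm hf0 hg0 hf hg⟩

/-- **Given `∀ d', LiebSahiContinuum d' n` (⟺ `C_n`): `φ^b_{p,q}` exists and is Sahi-positive of order `n`** for all
measurable nonnegative monotone functionals of the infinite configuration. [this work] -/
theorem exists_isRandomClusterLimit_msahiE_nonneg (hd : 0 < d) (b : RCBoundary) (hp : p ∈ Set.Icc (0 : ℝ) 1)
    (hq : 1 ≤ q) (hL : ∀ d', LiebSahiContinuum d' n) :
    ∃ P : Measure (BondConfig (Site d)), IsRandomClusterLimit d b p q P ∧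
      ∀ f : Fin n → BondConfig (Site d) → ℝ, (∀ i, Measurable (f i)) → (∀ i x, 0 ≤ f i x) → (∀ i, Monotone (f i)) →
        0 ≤ msahiE P n f := by
  obtain ⟨P, hP⟩ := exists_isRandomClusterLimit hd b hp hq
  exact ⟨P, hP, fun f hfm hf0 hmono => isRandomClusterLimit_msahiE_nonneg' hd hP hp hq hL f hfm hf0 hmono⟩

/-- **`C_n` ⟹ `φ^b_{p,q}` exists and is Sahi-positive of order `n`** (in particular FK–Ising, `q = 2`).
[this work; cite: Sahi2008, Conj. 5 (p. 212); LiebSahi2021, Conj. 1.1] -/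
theorem exists_isRandomClusterLimit_msahiE_nonneg_of_sahiConjecture (hd : 0 < d) (b : RCBoundary)
    (hp : p ∈ Set.Icc (0 : ℝ) 1) (hq : 1 ≤ q) (hC : SahiConjecture n) :
    ∃ P : Measure (BondConfig (Site d)), IsRandomClusterLimit d b p q P ∧
      ∀ f : Fin n → BondConfig (Site d) → ℝ, (∀ i, Measurable (f i)) → (∀ i x, 0 ≤ f i x) → (∀ i, Monotone (f i)) →
        0 ≤ msahiE P n f :=
  exists_isRandomClusterLimit_msahiE_nonneg hd b hp hq ((sahiConjecture_iff_forall_liebSahiContinuum n).1 hC)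

end Summit.CriticalPhenomena.PercolationContinuityZ3.Theorems.SahiBoxTP2
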